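import Literature.NumberTheory.Automorphic.PartialAsaiLHolomorphy
import Literature.NumberTheory.Automorphic.AsaiSignContRankOne
import Literature.NumberTheory.Automorphic.PairLFunctionPolesGLOneProofs
import Literature.NumberTheory.Automorphic.BaseChangeCyclicCuspidalProofs
import HarnessLib

/-!
# Grbac–Shahidi 2015, Thm. 4.3 (1), (2)(a) in rank one: the `GL(1)` stratum of the named fact
# `GrbacShahidi2015_partialAsaiL_holomorphy`, proved

Topic `NumberTheory/Automorphic`; namespace `Literature.NumberTheory.Automorphic`. Proof file
(theorems only: no definition, no named fact, no instance), sibling of `PartialAsaiLHolomorphy` (the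
named fact: N. Grbac, F. Shahidi, *Endoscopic transfer for unitary groups and holomorphy of Asai
`L`-functions*, Pacific J. Math. 276 (2015), Thm. 4.3 (1), (2)(a) — `s (s - 1) L^S(s, Π₀, As^±)` is
the restriction of an ENTIRE function, and `L^S(s, Π₀, As^±)` itself is unless `Π₀` is conjugate
self-dual almost everywhere — for every cuspidal `Π₀ ≤ L²_cusp(GL_N(E) A_G \ GL_N(𝔸_E))`, `E/F`
quadratic) and of `AsaiSignContRankOne` / `AsaiAtOneRankOne` (the rank-one strata of the two Asai
facts at `s = 1`, whose Hecke-character dictionary is reused here).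

## What is proved

* `GrbacShahidi2015_partialAsaiL_holomorphy_rank_one` (**main**) — the named fact **for `N = 1`**,
  verbatim (same binders, `σ₀ = 1`): for every quadratic `E/F` with `c ≠ 1`, every cuspidal
  `Π ≤ L²_cusp(GL₁(E) A_G \ GL₁(𝔸_E))`, every finite `S`, every `L²` Satake family `A` of `Π` off the
  places above `S` with the `c`-fixed places off `S` inert, and every sign `η`: some ENTIRE `G` has
  `G(s) = s (s - 1) L^S(s, Π, As^η)` on `{1 < Re s}`, and if `A` is not conjugate self-dual almost
  everywhere some ENTIRE `H` has `H(s) = L^S(s, Π, As^η)` there. No hypothesis beyond those of the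
  fact; axioms `propext`, `Classical.choice`, `Quot.sound`.
* `GrbacShahidi2015_partialAsaiL_holomorphy_of_two_le` — consequently the named fact is implied by
  (equivalent to) its own restriction to ranks `N ≥ 2`; what remains of it is Grbac–Shahidi's theorem
  proper (the Langlands–Shahidi method for the Siegel parabolic of `U(N, N)`, `N ≥ 2`, and Mok's
  endoscopic classification), resp. Flicker's Rankin–Selberg integrals for `As⁺`.
* `isUnramifiedAt_asaiHeckeCharacter_rank_one` — the two Hecke characters `ψ₀ = χ_Π|_{𝕀_F}` and
  `ψ₀ ω_{E/F}` whose Euler factors are the unramified `As^±` factors of `Π` are UNRAMIFIED at every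
  `v ∉ S` (so Hecke's continuation applies with no auxiliary bad places and yields entire, not merely
  half-plane, continuations — the one point where this file goes beyond `AsaiSignContRankOne`);
  `HeightOneSpectrum.ramificationIdxIn_eq_one_of_asai` — the places of `F` off an Asai datum are
  unramified in `E` (`e_v = 1`).

## Proof (Grbac–Shahidi pp. 204–206 for `n = 1`: the Langlands–Shahidi method is Hecke–Tate theory)

1. *Dictionary* (`GLOneStandardLTate`, `PairLFunctionPolesGLOneProofs`): `Π` acts through its Hecke
   character `χ = χ_Π` of `E`, unitary and trivial on `A_G = ℝ_{>0}`
   (`CuspidalAutomorphicRepGL.heckeCharacter_posRealIdele`); an honest Satake family off `S_E` is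
   `A w = {χ(ϖ_w)}` with `χ` unramified at `w ∉ S_E`
   (`IsSatakeFamilyOf.eq_singleton_valueAtUniformizer`, `.isUnramifiedAt_heckeCharacter`).
2. *The two Hecke characters of `F`*: `ψ₀ = χ|_{𝕀_F}` (`HeckeCharacter.exists_restrict`; unitary,
   trivial on `A_G` by `ideleBaseChange_posRealIdele`, unramified below unramified places,
   `isUnramifiedAt_restrict`) and `ψ₀ ω` with `ω = ω_{E/F}` the class-field character
   (`exists_isClassFieldCharacter_holds`; `ω² = 1`, so trivial on `A_G`; unramified at the places
   unramified in `E`, `IsClassFieldCharacter.isUnramifiedAt_of_ramificationIdxIn_eq_one`, which are all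
   `v ∉ S` since the `c`-fixed places off `S` are inert; `ω(ϖ_v) = -1` at inert and `+1` at split
   `v ∉ S`, `IsClassFieldCharacter.valueAtUniformizer_eq_ite_smul` — Artin reciprocity for `ω`).
3. *Flicker's unramified computation in rank one* (`eval_asaiLocalPolynomial_rankOne`, pp. 305–306):
   the unramified factor of `L^S(s, Π, As⁺)` at `v ∉ S` is the Hecke factor of `ψ₀`, that of
   `L^S(s, Π, As⁻)` the Hecke factor of `ψ₀ ω` (Grbac–Shahidi's identity `(∗∗)`, p. 205, split into
   its halves; `L(s, σ ⊗ δ̂, r_A) = L(s, σ, As⁻)`, p. 206).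
4. *Hecke's theorem, entire form* (`exists_entire_continuation_partialHeckeL`: Iwasawa Thm. 3.1,
   Prop. 4.4; Tate Thm. 4.4.1): for `ψ ∈ {ψ₀, ψ₀ ω}` unitary, trivial on `A_G`, unramified off the
   finite `S`, `(s - 1)^{[ψ = 1]} L^S(s, ψ)` is ENTIRE; hence `G = s (s - 1)^{1 - [ψ = 1]} · (that)` is
   entire and equals `s (s - 1) L^S(s, Π, As^η)` on `{1 < Re s}` — clause (i) of the fact with `σ₀ = 1`
   (Thm. 4.3 (2)(a): "entire, except for possible simple poles at `s = 0` and `s = 1`").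
5. *Clause (ii) by contraposition* (Thm. 4.3 (1): "if `σ` is not Galois self-dual … `L(s, σ, r_A)` is
   entire"): if the relevant `ψ` IS trivial, every unramified Asai factor is `1 - T`, i.e. `η a = 1`
   at an inert `v` (`a = χ(ϖ_{w_v}) = ±1 = a⁻¹`) and `a b = 1` at a split one
   (`b = χ(ϖ_{c w_v}) = a⁻¹`), so `A (c • w) = (A w)⁻¹` at EVERY `w ∉ S_E`, a cofinite set
   (`finite_setOf_under_mem`): the family is conjugate self-dual almost everywhere. Otherwise
   `[ψ = 1] = 0` and `H = G_Hecke` is the entire continuation of `L^S` itself.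

## References

* N. Grbac, F. Shahidi, *Endoscopic transfer for unitary groups and holomorphy of Asai
  `L`-functions*, Pacific J. Math. 276 (2015), 185–211: Thm. 4.3 (1), (2)(a) (pp. 186, 204), §2.A
  (pp. 190–191), proof pp. 204–206 (identity `(∗∗)` p. 205, `σ ⊗ δ̂` p. 206). [GrbacShahidi2015]
* Y. Z. Flicker, *Twisted tensors and Euler products*, Bull. Soc. Math. France 116 (1988), 295–313,
  Theorem p. 297 and pp. 305–306. [Flicker1988]
* J. Tate, *Fourier analysis in number fields and Hecke's zeta-functions*, Thm. 4.4.1, and *Global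
  class field theory*, Ch. VII §5.1 Main Theorem (B), in Cassels–Fröhlich (1967). [TateThesis1967]
  [CasselsFrohlichANT1967]
* K. Iwasawa, *Hecke's `L`-functions* (Princeton lectures 1964), SpringerBriefs (2019), Thm. 3.1,
  Prop. 4.4. [Iwasawa2019]
* J. Arthur, L. Clozel, *Simple algebras, base change, and the advanced theory of the trace formula*,
  Ann. of Math. Stud. 120 (1989), Ch. 3, proof of Thm. 3.1 (p. 201) (`ω` unramified outside the
  places ramified in `E`; the values `ω(ϖ_v)`). [ArthurClozelAMS120]
-/

noncomputable section

open scoped Topology NNReal Classical MatrixGroups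
open NumberField IsDedekindDomain MeasureTheory Filter

namespace Literature.NumberTheory.Automorphic

open Literature.NumberTheory.GaloisRepresentations AdelicGroupData

section RankOne

variable {F E : Type} [Field F] [NumberField F] [Field E] [NumberField E] [Algebra F E]

/-- `1(ϖ_v) = 1` (a copy of the private `valueAtUniformizer_one` lemmas of the sibling files).
[folklore] -/
private theorem valueAtUniformizer_one_holRankOne {K : Type} [Field K] [NumberField K]
    (v : HeightOneSpectrum (𝓞 K)) : (1 : HeckeCharacter K).valueAtUniformizer v = 1 := by
  rw [HeckeCharacter.valueAtUniformizer, HeckeCharacter.localComponent_apply,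
    HeckeCharacter.one_apply, Units.val_one]

/-- **Above an Asai datum the base place is unramified in `E`**: if the `c`-fixed places above `v`
have residue degree `2`, then `e_v = 1` (read at the chosen place `w_v = placeAbove E v`: inert gives
`e = 1, f = 2`, split gives `e = f = 1`). [folklore] -/
theorem HeightOneSpectrum.ramificationIdxIn_eq_one_of_asai (h2 : Module.finrank F E = 2)
    {c : E ≃ₐ[F] E} {v : HeightOneSpectrum (𝓞 F)}
    (hinert : ∀ w : HeightOneSpectrum (𝓞 E), w.under (𝓞 F) = v → c • w = w →
      w.asIdeal.inertiaDeg (𝓞 F) = 2) :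
    v.asIdeal.ramificationIdxIn (𝓞 E) = 1 := by
  have hw₀v : (placeAbove E v).under (𝓞 F) = v := placeAbove_under v
  by_cases hfix : c • placeAbove E v = placeAbove E v
  · have h := (HeightOneSpectrum.ramificationIdxIn_eq_one_of_inertiaDeg_eq_two h2
      (hinert _ hw₀v hfix)).1
    rwa [hw₀v] at h
  · have h := (HeightOneSpectrum.ramificationIdxIn_eq_one_of_smul_ne h2 hfix).1
    rwa [hw₀v] at h

/-- **The Hecke characters behind the unramified Asai factors are unramified off `S`.** Let `χ` be a
Hecke character of `E` unramified at every place above `v`, `ψ₀ = χ|_{𝕀_F}` its restriction and `ω`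
the class-field character of the quadratic `E/F`; if the `c`-fixed places above `v` are inert, then
`ψ₀` and `ψ₀ ω` are unramified at `v` (`isUnramifiedAt_restrict`; `v` is unramified in `E`, so `ω`
is unramified at `v` — Arthur–Clozel p. 201, `IsClassFieldCharacter.isUnramifiedAt_of_ramificationIdxIn_eq_one`).
[cite: ArthurClozelAMS120, Ch. 3, proof of Thm. 3.1 (p. 201)] -/
theorem isUnramifiedAt_asaiHeckeCharacter_rank_one (h2 : Module.finrank F E = 2) {c : E ≃ₐ[F] E}
    (hc : c ≠ 1) {χ : HeckeCharacter E} {ψ₀ ω : HeckeCharacter F}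
    (hψ₀ : ∀ x, ψ₀ x = χ (AdeleRing.ideleBaseChange F E x))
    (hω : haveI : FiniteDimensional F E := Module.finite_of_finrank_eq_succ h2
      ω.IsClassFieldCharacter E)
    {v : HeightOneSpectrum (𝓞 F)}
    (hunr : ∀ w : HeightOneSpectrum (𝓞 E), w.under (𝓞 F) = v → χ.IsUnramifiedAt w)
    (hinert : ∀ w : HeightOneSpectrum (𝓞 E), w.under (𝓞 F) = v → c • w = w →
      w.asIdeal.inertiaDeg (𝓞 F) = 2) :
    ψ₀.IsUnramifiedAt v ∧ (ψ₀ * ω).IsUnramifiedAt v := by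
  haveI hquad : Algebra.IsQuadraticExtension F E := { finrank_eq_two' := h2 }
  haveI : FiniteDimensional F E := Module.finite_of_finrank_eq_succ h2
  have hprime : (Module.finrank F E).Prime := by rw [h2]; exact Nat.prime_two
  have hψ₀v : ψ₀.IsUnramifiedAt v :=
    HeckeCharacter.isUnramifiedAt_restrict hψ₀ _ (HeightOneSpectrum.mem_pair_placeAbove_iff h2 hc v)
      hunr
  have hωv : ω.IsUnramifiedAt v :=
    hω.isUnramifiedAt_of_ramificationIdxIn_eq_one hprime
      (HeightOneSpectrum.ramificationIdxIn_eq_one_of_asai h2 hinert)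
  exact ⟨hψ₀v, hψ₀v.mul hωv⟩

/-- **Grbac–Shahidi 2015, Thm. 4.3 (1), (2)(a) — the named fact
`GrbacShahidi2015_partialAsaiL_holomorphy` — for `GL(1)`, proved.** For a quadratic extension `E/F`
of number fields with non-trivial automorphism `c`, a cuspidal `Π ≤ L²_cusp(GL₁(E) A_G \ GL₁(𝔸_E))`,
a finite set `S` of places of `F`, a Satake family `A` of `Π` off the places of `E` above `S` such
that the `c`-fixed places off `S` are inert, and a sign `η`: with `σ₀ = 1`, (i) some ENTIRE `G`
satisfies `G(s) = s (s - 1) L^S(s, Π, As^η)` for `Re s > 1`, and (ii) if the family is NOT conjugate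
self-dual almost everywhere then some ENTIRE `H` satisfies `H(s) = L^S(s, Π, As^η)` for `Re s > 1`
— verbatim the conclusion of the named fact at `N = 1`.

Proof (Grbac–Shahidi's pp. 204–206 in the degenerate instance `n = 1`, where the Langlands–Shahidi
method is Hecke–Tate theory; every input is a theorem of the tree): `Π` acts through its unitary
Hecke character `χ`, trivial on `A_G`, with `A w = {χ(ϖ_w)}` and `χ` unramified off `S_E`
(`GLOneStandardLTate`); by Flicker's unramified computation in rank one
(`eval_asaiLocalPolynomial_rankOne`) and the decomposition law `ω_{E/F}(ϖ_v) = ∓1` at inert/split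
`v ∉ S` (`IsClassFieldCharacter.valueAtUniformizer_eq_ite_smul`), `L^S(s, Π, As⁺) = L_F^S(s, ψ₀)` and
`L^S(s, Π, As⁻) = L_F^S(s, ψ₀ ω_{E/F})` factor by factor, `ψ₀ = χ|_{𝕀_F}`; both characters are
unitary, trivial on `A_G` and unramified off `S` (`isUnramifiedAt_asaiHeckeCharacter_rank_one`), so by
Hecke's theorem (`exists_entire_continuation_partialHeckeL`) `(s - 1)^{[ψ = 1]} L_F^S(s, ψ)` is entire,
whence (i) with `G = s (s - 1)^{1 - [ψ = 1]} · (that)`; for (ii), if `ψ = 1` every unramified Asai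
factor is `1 - T`, forcing `χ(ϖ_{c w}) = χ(ϖ_w)⁻¹` at every `w ∉ S_E` (inert: `η χ(ϖ_w) = 1`; split:
`χ(ϖ_w) χ(ϖ_{c w}) = 1`), i.e. conjugate self-duality almost everywhere — so otherwise `[ψ = 1] = 0`.
[cite: GrbacShahidi2015, Thm. 4.3 (1), (2)(a), §2.A pp. 190–191 and proof pp. 204–206]
[cite: Flicker1988, Theorem p. 297 and pp. 305–306] [cite: TateThesis1967, Thm. 4.4.1]
[cite: Iwasawa2019, Thm. 3.1 and Ch. 4 §4.2 Prop. 4.4] -/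
theorem GrbacShahidi2015_partialAsaiL_holomorphy_rank_one
    (F E : Type) [Field F] [NumberField F] [Field E] [NumberField E] [Algebra F E] (c : E ≃ₐ[F] E)
    (h2 : Module.finrank F E = 2) (hc : c ≠ 1)
    (μ : Measure (gl 1 E).automorphicQuotient) [(gl 1 E).IsAutomorphicMeasure μ]
    (P : CuspidalAutomorphicRepGL 1 E μ)
    (S : Set (HeightOneSpectrum (𝓞 F))) (A : SatakeFamily E) (η : ℤˣ) (hS : S.Finite)
    (hA : IsSatakeFamilyOf P {w : HeightOneSpectrum (𝓞 E) | w.under (𝓞 F) ∈ S} A)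
    (hin : ∀ w : HeightOneSpectrum (𝓞 E), w.under (𝓞 F) ∉ S → c • w = w →
      w.asIdeal.inertiaDeg (𝓞 F) = 2) :
    ∃ σ₀ : ℝ, 1 ≤ σ₀ ∧
      (∃ G : ℂ → ℂ, Differentiable ℂ G ∧
        ∀ s : ℂ, σ₀ < s.re → G s = s * (s - 1) * partialAsaiL S c A η s) ∧
      ((¬ ∀ᶠ w : HeightOneSpectrum (𝓞 E) in cofinite, A (c • w) = (A w).map (·⁻¹)) →
        ∃ H : ℂ → ℂ, Differentiable ℂ H ∧
          ∀ s : ℂ, σ₀ < s.re → H s = partialAsaiL S c A η s) := by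
  haveI hquad : Algebra.IsQuadraticExtension F E := { finrank_eq_two' := h2 }
  haveI : FiniteDimensional F E := Module.finite_of_finrank_eq_succ h2
  haveI : Fact (Module.finrank F E).Prime := ⟨by rw [h2]; exact Nat.prime_two⟩
  haveI : IsCyclic (E ≃ₐ[F] E) := isCyclic_of_prime_card (IsGalois.card_aut_eq_finrank F E)
  have hcc : c * c = 1 := AlgEquiv.mul_self_eq_one_of_finrank_eq_two h2 c
  /- Step 1: the Hecke character `χ` of `Π`: unitary, trivial on `A_G`; `A w = {χ(ϖ_w)}` and `χ`
  unramified at `w`, for `w ∉ S_E` -/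
  set χ : HeckeCharacter E := P.heckeCharacter with hχdef
  have hχu : χ.IsUnitary := P.isUnitary_heckeCharacter
  have hχA : ∀ t : ℝ≥0ˣ, χ (posRealIdele E t) = 1 := P.heckeCharacter_posRealIdele
  have hAχ : ∀ w : HeightOneSpectrum (𝓞 E), w.under (𝓞 F) ∉ S →
      A w = {χ.valueAtUniformizer w} ∧ χ.IsUnramifiedAt w := fun w hw =>
    ⟨hA.eq_singleton_valueAtUniformizer hw, hA.isUnramifiedAt_heckeCharacter hw⟩
  -- the trivial norm twist, to feed `eval_asaiLocalPolynomial_rankOne` (`χ = χ · ‖·‖⁰`)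
  have hν : ∀ x : ideleGroup E, (((1 : HeckeCharacter E) x : ℂˣ) : ℂ) =
      ((ideleNorm x : ℝ) : ℂ) ^ (0 : ℂ) := fun x => by
    rw [HeckeCharacter.one_apply, Units.val_one, Complex.cpow_zero]
  have hχ1 : χ = χ * 1 := (mul_one χ).symm
  /- Step 2: `ψ₀ = χ|_{𝕀_F}` and the class-field character `ω` of `E/F` (`ω ≠ 1`, `ω² = 1`) -/
  obtain ⟨ψ₀, hψ₀⟩ := χ.exists_restrict F
  have hψ₀u : ψ₀.IsUnitary := fun x => by rw [hψ₀]; exact hχu _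
  have hψ₀A : ∀ t : ℝ≥0ˣ, ψ₀ (posRealIdele F t) = 1 := fun t => by
    rw [hψ₀, AdeleRing.ideleBaseChange_posRealIdele]
    exact hχA t
  obtain ⟨ω, hω, hordω⟩ := (exists_isClassFieldCharacter_holds (F := F) (E := E) :
    ∃ η : HeckeCharacter F, η.IsClassFieldCharacter E ∧ orderOf η = Module.finrank F E)
  rw [h2] at hordω
  have hω2 : ω ^ 2 = 1 := by rw [← hordω]; exact pow_orderOf_eq_one ω
  have hωu : ω.IsUnitary := hω.isUnitary
  have hωA : ∀ t : ℝ≥0ˣ, ω (posRealIdele F t) = 1 :=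
    HeckeCharacter.map_posRealIdele_eq_one_of_sq hω2
  /- the two Hecke characters `Ψ(+1) = ψ₀` (for `As⁺`) and `Ψ(-1) = ψ₀ ω` (for `As⁻`) -/
  set Ψ : ℤˣ → HeckeCharacter F := fun θ => if θ = 1 then ψ₀ else ψ₀ * ω with hΨ
  have hΨ1 : Ψ 1 = ψ₀ := if_pos rfl
  have hΨm : Ψ (-1) = ψ₀ * ω := if_neg (by decide)
  have hΨu : ∀ θ, (Ψ θ).IsUnitary := fun θ => by
    rcases Int.units_eq_one_or θ with rfl | rfl
    · rw [hΨ1]; exact hψ₀u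
    · rw [hΨm]; exact hψ₀u.mul hωu
  have hΨA : ∀ (θ : ℤˣ) (t : ℝ≥0ˣ), Ψ θ (posRealIdele F t) = 1 := fun θ t => by
    rcases Int.units_eq_one_or θ with rfl | rfl
    · rw [hΨ1]; exact hψ₀A t
    · rw [hΨm, HeckeCharacter.mul_apply, hψ₀A t, hωA t, one_mul]
  /- Step 3: hypotheses above `v ∉ S`: inertness of the `c`-fixed places, unramifiedness of `χ` -/
  have hinert : ∀ v ∉ S, ∀ w : HeightOneSpectrum (𝓞 E), w.under (𝓞 F) = v → c • w = w →
      w.asIdeal.inertiaDeg (𝓞 F) = 2 := fun v hv w hw hcw => hin w (by rw [hw]; exact hv) hcw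
  have hunrv : ∀ v ∉ S, ∀ w : HeightOneSpectrum (𝓞 E), w.under (𝓞 F) = v → χ.IsUnramifiedAt w :=
    fun v hv w hw => (hAχ w (by rw [hw]; exact hv)).2
  /- Step 4: `Ψ θ` is unramified at every `v ∉ S` -/
  have hΨur : ∀ (θ : ℤˣ), ∀ v ∉ S, (Ψ θ).IsUnramifiedAt v := by
    intro θ v hv
    obtain ⟨h₀, h₁⟩ := isUnramifiedAt_asaiHeckeCharacter_rank_one h2 hc hψ₀ hω (hunrv v hv)
      (hinert v hv)
    rcases Int.units_eq_one_or θ with rfl | rfl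
    · rw [hΨ1]; exact h₀
    · rw [hΨm]; exact h₁
  /- Step 5: the unramified Asai factors are the Hecke factors of `Ψ θ`, at every `v ∉ S` -/
  have hfac : ∀ (θ : ℤˣ), ∀ v ∉ S, ∀ x : ℂ,
      (asaiLocalPolynomial c A θ (placeAbove E v)).eval x =
        1 - (Ψ θ).valueAtUniformizer v * x := by
    intro θ v hv x
    have hωv := hω.valueAtUniformizer_eq_ite_smul h2 (c := c) (hinert v hv)
    rw [eval_asaiLocalPolynomial_rankOne h2 hc hν hχ1 hψ₀
      (fun w hw => (hAχ w (by rw [hw]; exact hv)).1) (hunrv v hv) (hinert v hv) θ x,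
      mul_zero, neg_zero, Complex.cpow_zero, mul_one]
    rcases Int.units_eq_one_or θ with rfl | rfl
    · have hite : (if c • placeAbove E v = placeAbove E v then ((((1 : ℤˣ) : ℤ)) : ℂ) else 1) = 1 := by
        split_ifs <;> simp
      rw [hite, one_mul, hΨ1]
    · have hite : (if c • placeAbove E v = placeAbove E v then ((((-1 : ℤˣ) : ℤ)) : ℂ) else 1) =
          ω.valueAtUniformizer v := by
        rw [hωv]
        split_ifs <;> simp
      rw [hite, hΨm, HeckeCharacter.valueAtUniformizer_mul]
      ring
  /- Step 6: Hecke's ENTIRE continuation of `(s - 1)^k L^S(s, Ψ η)`, `k = [Ψ η = 1]`, off `T = S` -/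
  obtain ⟨k, G, hk, hGd, hGeq, -⟩ :=
    exists_entire_continuation_partialHeckeL (Ψ η) (hΨu η) (hΨA η) hS (hΨur η)
  have hGL : ∀ s : ℂ, 1 < s.re → G s = (s - 1) ^ k * partialAsaiL S c A η s := fun s hs => by
    rw [hGeq s hs, partialAsaiL_eq_tprod_of_heckeCharacter c A η (hfac η) s]
  have hk1 : k ≤ 1 := by
    rw [hk]
    split_ifs <;> simp
  refine ⟨1, le_rfl, ⟨fun s => s * (s - 1) ^ (1 - k) * G s, ?_, ?_⟩, ?_⟩
  · -- (i): `G' = s (s - 1)^{1 - k} G` is entire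
    exact (differentiable_id.mul ((differentiable_id.sub_const 1).pow _)).mul hGd
  · -- (i): `G' = s (s - 1) L^S` on `{1 < Re s}`
    intro s hs
    show s * (s - 1) ^ (1 - k) * G s = s * (s - 1) * partialAsaiL S c A η s
    rw [hGL s hs, ← mul_assoc, mul_assoc s, ← pow_add, Nat.sub_add_cancel hk1, pow_one]
  · /- Step 7: clause (ii) by contraposition — `Ψ η = 1` forces conjugate self-duality a.e. -/
    intro hn
    have hne : Ψ η ≠ 1 := by
      intro h1
      apply hn
      -- every unramified Asai factor is `1 - T`
      have hfac1 : ∀ v ∉ S, ∀ x : ℂ, (asaiLocalPolynomial c A η (placeAbove E v)).eval x = 1 - x :=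
        fun v hv x => by rw [hfac η v hv x, h1, valueAtUniformizer_one_holRankOne, one_mul]
      have hev : ∀ᶠ w : HeightOneSpectrum (𝓞 E) in cofinite, w.under (𝓞 F) ∉ S := by
        rw [Filter.eventually_cofinite]
        simpa using finite_setOf_under_mem hS
      filter_upwards [hev] with w hw
      -- `w ∈ {w₀, c • w₀}` for the chosen place `w₀` above `v = w ∩ 𝓞 F`
      set v : HeightOneSpectrum (𝓞 F) := w.under (𝓞 F) with hvdef
      set w₀ : HeightOneSpectrum (𝓞 E) := placeAbove E v with hw₀def
      have hw₀v : w₀.under (𝓞 F) = v := placeAbove_under v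
      have hcw₀v : (c • w₀).under (𝓞 F) = v :=
        (HeightOneSpectrum.under_algEquiv_smul F E c w₀).trans hw₀v
      have ha := (hAχ w₀ (by rw [hw₀v]; exact hw)).1
      have hb := (hAχ (c • w₀) (by rw [hcw₀v]; exact hw)).1
      have hane : χ.valueAtUniformizer w₀ ≠ 0 := by
        simp only [HeckeCharacter.valueAtUniformizer]
        exact Units.ne_zero _
      have key := hfac1 v hw 1
      have hww₀ : w = w₀ ∨ w = c • w₀ :=
        HeightOneSpectrum.eq_or_eq_smul_of_under_eq h2 hc (by rw [hw₀v])
      by_cases hfix : c • w₀ = w₀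
      · -- inert: `1 - η a = 1 - 1`, so `a = η⁻¹ = ±1 = a⁻¹`
        rw [asaiLocalPolynomial_of_smul_eq A η hfix, ha, asaiInertPolynomial_singleton] at key
        simp only [Polynomial.eval_sub, Polynomial.eval_one, Polynomial.eval_mul, Polynomial.eval_C,
          Polynomial.eval_X, mul_one, sub_self, sub_eq_zero] at key
        have hainv : (χ.valueAtUniformizer w₀)⁻¹ = χ.valueAtUniformizer w₀ := by
          rcases Int.units_eq_one_or η with rfl | rfl
          · have h : χ.valueAtUniformizer w₀ = 1 := by simpa using key.symm
            rw [h, inv_one]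
          · have h : χ.valueAtUniformizer w₀ = -1 := by
              have h' : -χ.valueAtUniformizer w₀ = 1 := by simpa using key.symm
              rw [← neg_neg (χ.valueAtUniformizer w₀), h']
            rw [h, inv_neg, inv_one]
        have hw' : w = w₀ := by
          rcases hww₀ with h | h
          · exact h
          · rw [h, hfix]
        rw [hw', hfix, ha, Multiset.map_singleton, hainv]
      · -- split: `1 - a b = 1 - 1`, so `b = a⁻¹`
        rw [asaiLocalPolynomial_of_smul_ne A η hfix, ha, hb, eval_satakePairPolynomial_singleton]
          at key
        simp only [mul_one, sub_self, sub_eq_zero] at key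
        have hab : χ.valueAtUniformizer w₀ * χ.valueAtUniformizer (c • w₀) = 1 := key.symm
        rcases hww₀ with h | h
        · rw [h, hb, ha, Multiset.map_singleton, eq_inv_of_mul_eq_one_right hab]
        · rw [h, HeightOneSpectrum.smul_smul_of_mul_self_eq_one hcc, ha, hb, Multiset.map_singleton,
            eq_inv_of_mul_eq_one_left hab]
    rw [if_neg hne] at hk
    subst hk
    exact ⟨G, hGd, fun s hs => by rw [hGL s hs, pow_zero, one_mul]⟩

/-- **The named fact reduced to ranks `N ≥ 2`.** `GrbacShahidi2015_partialAsaiL_holomorphy` follows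
from its own restriction to cuspidal `Π` of rank `N ≥ 2` — the rank-one stratum being the theorem
`GrbacShahidi2015_partialAsaiL_holomorphy_rank_one`. (What remains is Grbac–Shahidi's Thm. 4.3 (1),
(2)(a) proper, `N ≥ 2`: the Langlands–Shahidi theory of the Siegel Eisenstein series on `U(N, N)`,
Thm. 2.1/4.1, and Mok's endoscopic classification; for `As⁺` also Flicker's Rankin–Selberg method.)
[cite: GrbacShahidi2015, Thm. 4.3 (1), (2)(a)] -/
theorem GrbacShahidi2015_partialAsaiL_holomorphy_of_two_le
    (h : ∀ (F E : Type) [Field F] [NumberField F] [Field E] [NumberField E] [Algebra F E]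
      (c : E ≃ₐ[F] E), Module.finrank F E = 2 → c ≠ 1 →
      ∀ (N : ℕ) (μ : Measure (gl N E).automorphicQuotient) [(gl N E).IsAutomorphicMeasure μ]
        (P : CuspidalAutomorphicRepGL N E μ), 2 ≤ N →
        ∀ (S : Set (HeightOneSpectrum (𝓞 F))) (A : SatakeFamily E) (η : ℤˣ), S.Finite →
          IsSatakeFamilyOf P {w : HeightOneSpectrum (𝓞 E) | w.under (𝓞 F) ∈ S} A →
          (∀ w : HeightOneSpectrum (𝓞 E), w.under (𝓞 F) ∉ S → c • w = w →
            w.asIdeal.inertiaDeg (𝓞 F) = 2) →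
          ∃ σ₀ : ℝ, 1 ≤ σ₀ ∧
            (∃ G : ℂ → ℂ, Differentiable ℂ G ∧
              ∀ s : ℂ, σ₀ < s.re → G s = s * (s - 1) * partialAsaiL S c A η s) ∧
            ((¬ ∀ᶠ w : HeightOneSpectrum (𝓞 E) in cofinite, A (c • w) = (A w).map (·⁻¹)) →
              ∃ H : ℂ → ℂ, Differentiable ℂ H ∧
                ∀ s : ℂ, σ₀ < s.re → H s = partialAsaiL S c A η s)) :
    GrbacShahidi2015_partialAsaiL_holomorphy := by
  intro F E _ _ _ _ _ c h2 hc N μ _ P hN S A η hS hA hin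
  rcases Nat.lt_or_ge N 2 with hN2 | hN2
  · obtain rfl : N = 1 := by omega
    exact GrbacShahidi2015_partialAsaiL_holomorphy_rank_one F E c h2 hc μ P S A η hS hA hin
  · exact h F E c h2 hc N μ P hN2 S A η hS hA hin

end RankOne

end Literature.NumberTheory.Automorphic
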